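import Literature.Barriers.CriticalPhenomena.RandomClusterFirstOrderNarrow
import Literature.Barriers.CriticalPhenomena.RandomClusterFirstOrderPS
import HarnessLib

/-!
# `RandomClusterFirstOrderNarrow` from the window dichotomy with a free rate uniform in `p`

Companion ("Proofs") file of `Literature.Barriers.CriticalPhenomena.RandomClusterFirstOrderNarrow`
(Grimmett 2006, Thm. (7.33)(b), BOTH halves: `θ⁰(p_c(q), q) = 0 < θ¹(p_c(q), q)` for `q > Q(d)`;
Laanait–Messager–Miracle-Solé–Ruiz–Shlosman 1991). Theorems only; no definitions, no named facts.

The pointwise Pirogov–Sinai analysis — at every `p` of a window one of the two phases is stable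
(Grimmett 2006, Thm. (7.42) with (7.62) `min(b_w, b_f) = 0`; in the tree's programme
`Literature.Probability.LatticeModels.PSStabilityInduction`: `exists_excess_eq_zero`,
`K_le_exp_of_excess_eq_zero`) — delivers the window DICHOTOMY of
`RandomClusterFirstOrder_of_dichotomy`
(`Literature.Barriers.CriticalPhenomena.RandomClusterFirstOrderProofs`, §7), which suffices for the
WIRED half, but no coexistence point (the coexistence entry point is
`RandomClusterFirstOrderNarrow_of_coexistence`). The FREE half at `p_c(q)` itself nevertheless
follows from the dichotomy as soon as the free alternative is kept in the quantitative form in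
which the Peierls argument produces it (Grimmett's (7.81): `φ⁰_Λ(x ↔ y) ≤ e^{-kτ|x-y|}` for all
large `Λ` and all `p ≤ p̃`, with `k`, `τ = τ(q)` depending on `q` only): a bound
`φ⁰_{Λ_{m+k},p,q}(0 ↔ ∂Λ_m in Λ_m) ≤ δ_m` for all `m, k`, with `δ_m → 0` NOT depending on `p`.
Indeed `θ¹(·, q) = 0` on `[0, p_c(q))` ((5.3)) excludes the wired alternative strictly below
`p_c(q)`, so the free bound holds on `(p_bot, p_c(q))`; and every finite-volume probability is a
continuous function of `p ∈ [0, 1]` (proof of Thm. (4.58);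
`Literature.Probability.LatticeModels.continuousWithinAt_rcMeasure_real`), so the bound passes to
the endpoint `p = p_c(q)` box by box — the finite-volume form of the left-continuity of the free
quantities (Thm. (4.19)(a), Prop. (4.28)(c)), used at the one point where the printed proof has
coexistence, `p̃ = p_c(q)` ((7.80) with (7.83)).

## Contents (everything proved)

* `mem_freeDecaySet_of_rate`: a free bound with vanishing rate is membership in `freeDecaySet`;
  `tendsto_const_mul_exp_neg_mul_natCast`: the exponential rates `C e^{-κ m}` of (7.81) vanish.
* `boxFreeReal_le_of_forall_mem_Ioo`: a bound on `φ⁰_{Λ_{m+k},p,q}(A)` valid for `p ∈ (a, b)`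
  holds at `p = b` (continuity in `p`).
* `rcCriticalProb_mem_freeDecaySet_of_dichotomyRate`: free decay AT `p_c(q)` from the dichotomy
  with a uniform free rate.
* `RandomClusterFirstOrderNarrow_of_dichotomyRate`: the narrowed barrier from the same hypothesis
  (wired half through `le_thetaWired_rcCriticalProb_of_dichotomy`).
* (2026-08-15) **`RandomClusterFirstOrderNarrow_holds` — the fact is PROVED.** The hypothesis of
  `RandomClusterFirstOrderNarrow_of_dichotomyRate` is what the Pirogov–Sinai analysis assembled in the
  sibling `Literature.Barriers.CriticalPhenomena.RandomClusterFirstOrderPS` (the file discharging the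
  catalogued barrier, `RandomClusterFirstOrder_holds`) delivers: beyond `RandomClusterFirstOrderPS.Qof d`,
  on the window `t ∈ [t_bot, t_top]`, `p = t²/(1+t²)` (`|2d log t - log q| ≤ 1`), some phase is stable at
  every `t` (`RandomClusterFirstOrderPS.exists_stable`); stability of `ord` gives uniform wired
  percolation `θ¹_{Λ_n} ≥ 1/2` (`RandomClusterFirstOrderPS.half_le_thetaWiredBox`, (7.79)) and stability
  of `dis` gives the free Peierls bound `φ⁰_{Λ_{m+k},p,q}(0 ↔ ∂Λ_m in Λ_m) ≤ B^{m+1}/(1-B) ≤ B^m/(1-B)`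
  with the Peierls ratio `B = B(q) ≤ 1/4` INDEPENDENT of `p` (the rate form of
  `RandomClusterFirstOrderPS.mem_freeDecaySet_of_dis`, from `RCBoxEnsembles`: (7.81)); `ord` is stable
  at the top of the window and `dis` at the bottom.

## References

* G. Grimmett, *The Random-Cluster Model*, Springer 2006: Thm. (4.19)(a), Prop. (4.28)(c), proof of
  Thm. (4.58) (continuity in `p`), (5.2)–(5.3), Prop. (5.11); §7.5: Thm. (7.33)(b) and its proof,
  eqs. (7.78)–(7.83); Thm. (7.42) with (7.44)–(7.46), (7.62). [Grimmett2006]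
* L. Laanait, A. Messager, S. Miracle-Solé, J. Ruiz, S. Shlosman, Comm. Math. Phys. 140 (1991)
  81–91 (Grimmett's [224]). [LaanaitMessagerMiracleSoleRuizShlosman1991]
* S. Friedli, Y. Velenik, *Statistical Mechanics of Lattice Systems*, CUP 2017, §7.3 (Lemma 7.26),
  §7.4.3 (Prop. 7.34). [FriedliVelenik2017]
-/

noncomputable section

namespace Literature.Barriers.CriticalPhenomena

open MeasureTheory Filter _root_.Topology Literature.Probability.LatticeModels
  Literature.Probability.Percolation

variable {d : ℕ}

/-- A free bound with a vanishing rate is free decay: if `φ⁰_{Λ_{m+k},p,q}(0 ↔ ∂Λ_m in Λ_m) ≤ δ_m`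
for all `m, k` and `δ_m → 0`, then `p ∈ freeDecaySet d q`.
[cite: Grimmett2006, proof of Thm. (7.33), eqs. (7.81)–(7.82)] -/
theorem mem_freeDecaySet_of_rate {q p : ℝ} {δ : ℕ → ℝ} (hδ : Tendsto δ atTop (𝓝 0))
    (h : ∀ m k : ℕ, boxFreeReal d p q m (originToBoundary d m) k ≤ δ m) :
    p ∈ freeDecaySet d q := by
  intro ε hε
  obtain ⟨m, hm⟩ := (hδ.eventually (Iic_mem_nhds hε)).exists
  exact ⟨m, fun k => (h m k).trans hm⟩

/-- The exponential rates of the printed proof vanish: `C e^{-κ m} → 0` (`κ > 0`), so a Peierls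
bound `φ⁰_{Λ_{m+k},p,q}(0 ↔ ∂Λ_m in Λ_m) ≤ C e^{-κ m}` is a free bound with vanishing rate.
[cite: Grimmett2006, proof of Thm. (7.33), eq. (7.81)] -/
theorem tendsto_const_mul_exp_neg_mul_natCast (C : ℝ) {κ : ℝ} (hκ : 0 < κ) :
    Tendsto (fun m : ℕ => C * Real.exp (-(κ * m))) atTop (𝓝 0) := by
  have h1 : Tendsto (fun m : ℕ => κ * (m : ℝ)) atTop atTop :=
    tendsto_natCast_atTop_atTop.const_mul_atTop hκ
  have h2 : Tendsto (fun m : ℕ => Real.exp (-(κ * m))) atTop (𝓝 0) :=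
    Real.tendsto_exp_neg_atTop_nhds_zero.comp h1
  simpa using h2.const_mul C

/-- **A free finite-volume bound passes to the right endpoint of an interval of parameters**
(`q > 0`): for fixed `m, k` and an event `A` of `Λ_m`, if `φ⁰_{Λ_{m+k},p,q}(A) ≤ c` for every
`p ∈ (a, b)` with `0 ≤ a < b ≤ 1`, then `φ⁰_{Λ_{m+k},b,q}(A) ≤ c` — the probability is a continuous
function of `p ∈ [0, 1]` (a quotient of polynomials with positive denominator).
[cite: Grimmett2006, proof of Thm. (4.58) (continuity of finite-volume quantities in p)] -/
theorem boxFreeReal_le_of_forall_mem_Ioo {q : ℝ} (hq : 0 < q) {a b c : ℝ} (ha : 0 ≤ a)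
    (hab : a < b) (hb : b ≤ 1) (m : ℕ) (A : Set (BondConfig (BoxV d m))) (k : ℕ)
    (h : ∀ p ∈ Set.Ioo a b, boxFreeReal d p q m A k ≤ c) : boxFreeReal d b q m A k ≤ c := by
  have hbI : b ∈ Set.Icc (0 : ℝ) 1 := ⟨ha.trans hab.le, hb⟩
  unfold boxFreeReal at h ⊢
  have hcont : ContinuousWithinAt
      (fun p : ℝ => (rcMeasure (finsetGraph (zdGraph d) (box d (m + k))) p q ∅).real
        (finsetRestrict (box_mono d (Nat.le_add_right m k)) ⁻¹' A)) (Set.Ioo a b) b := by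
    have h0 := continuousWithinAt_rcMeasure_real (finsetGraph (zdGraph d) (box d (m + k))) hq
      (∅ : Set (BoxV d (m + k))) (finsetRestrict (box_mono d (Nat.le_add_right m k)) ⁻¹' A) hbI
    exact h0.mono fun p hp => ⟨ha.trans hp.1.le, hp.2.le.trans hb⟩
  haveI : (𝓝[Set.Ioo a b] b).NeBot := by
    rw [nhdsWithin_Ioo_eq_nhdsLT hab]
    infer_instance
  refine le_of_tendsto hcont ?_
  filter_upwards [self_mem_nhdsWithin] with p hp
  exact h p hp

/-- **Free decay AT `p_c(q)` from the window dichotomy with a uniform free rate** (`q ≥ 1`,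
`d ≥ 1`). Suppose that on a window `0 ≤ p_bot ≤ p_top < 1`, with some `c > 0` and some rate
`δ_m → 0` independent of `p`: (i) at every `p ∈ [p_bot, p_top]` either the wired box measures
percolate uniformly (`c ≤ φ¹_{Λ_n,p,q}(0 ↔ ∂Λ_n)` for all `n`) or the free bound
`φ⁰_{Λ_{m+k},p,q}(0 ↔ ∂Λ_m in Λ_m) ≤ δ_m` holds for all `m, k`; (ii) the wired alternative holds at
`p_top`; (iii) the free one at `p_bot`. Then `p_c(q) ∈ freeDecaySet d q`, i.e. the free half
`θ⁰(p_c(q), q) = 0` of Thm. (7.33)(b). Proof: (iii) gives `p_bot ≤ p_c(q)`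
(`le_rcCriticalProb_of_freeDecay`) and (ii) gives `p_c(q) ≤ p_top`; if `p_bot = p_c(q)` we are
done by (iii); otherwise on `(p_bot, p_c(q))` the wired alternative is impossible (`θ¹ = 0` below
`p_c(q)`, (5.3)), so the free bound holds there, and it passes to `p_c(q)` box by box by
continuity in `p` (`boxFreeReal_le_of_forall_mem_Ioo`).
[cite: Grimmett2006, proof of Thm. (7.33), eqs. (7.81)–(7.83), with Thm. (7.42), eq. (7.62), (5.3) and proof of Thm. (4.58)] -/
theorem rcCriticalProb_mem_freeDecaySet_of_dichotomyRate (hd : 0 < d) {q : ℝ} (hq : 1 ≤ q)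
    {pbot ptop c : ℝ} {δ : ℕ → ℝ} (hc : 0 < c) (hbot : 0 ≤ pbot) (hbt : pbot ≤ ptop)
    (htop : ptop < 1) (hδ : Tendsto δ atTop (𝓝 0))
    (hdich : ∀ p ∈ Set.Icc pbot ptop, p ∈ wiredPercolationSet d q c ∨
      ∀ m k : ℕ, boxFreeReal d p q m (originToBoundary d m) k ≤ δ m)
    (hWP : ptop ∈ wiredPercolationSet d q c)
    (hFD : ∀ m k : ℕ, boxFreeReal d pbot q m (originToBoundary d m) k ≤ δ m) :
    rcCriticalProb d q ∈ freeDecaySet d q := by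
  have hq0 : 0 < q := one_pos.trans_le hq
  have htopI : ptop ∈ Set.Icc (0 : ℝ) 1 := ⟨hbot.trans hbt, htop.le⟩
  -- `p_c ≤ p_top` from (ii), `p_bot ≤ p_c` from (iii)
  have hpc_top : rcCriticalProb d q ≤ ptop :=
    rcCriticalProb_le_of_thetaWired_pos hq htopI
      (hc.trans_le (le_thetaWired_of_forall fun n => hWP (n + 1)))
  have hbot_pc : pbot ≤ rcCriticalProb d q :=
    le_rcCriticalProb_of_freeDecay hd hq (hbt.trans htop.le) (mem_freeDecaySet_of_rate hδ hFD)
  refine mem_freeDecaySet_of_rate hδ fun m k => ?_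
  rcases hbot_pc.eq_or_lt with heq | hlt
  · rw [← heq]
    exact hFD m k
  · -- on `(p_bot, p_c)` the wired alternative would give `θ¹ ≥ c > 0` strictly below `p_c`
    refine boxFreeReal_le_of_forall_mem_Ioo hq0 hbot hlt (hpc_top.trans htop.le) m _ k
      fun p hp => ?_
    rcases hdich p ⟨hp.1.le, hp.2.le.trans hpc_top⟩ with hwp | hfree
    · exfalso
      have hpos : 0 < thetaWired d p q :=
        hc.trans_le (le_thetaWired_of_forall fun n => hwp (n + 1))
      exact hpos.ne' (thetaWired_eq_zero_of_lt_rcCriticalProb hq (hbot.trans hp.1.le) hp.2)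
    · exact hfree m k

/-- **The narrowed barrier from the window dichotomy with a uniform free rate.** If for every
`d ≥ 2` there is `Q(d)` such that for all real `q > Q`, `q ≥ 1`, some window
`0 ≤ p_bot ≤ p_top < 1`, some `c > 0` and some rate `δ_m → 0` satisfy (i)–(iii) of
`rcCriticalProb_mem_freeDecaySet_of_dichotomyRate`, then `RandomClusterFirstOrderNarrow` holds:
the free half by that theorem, the wired half `θ¹(p_c(q), q) ≥ c > 0` by
`le_thetaWired_rcCriticalProb_of_dichotomy` (the free bound implies membership in `freeDecaySet`,
`mem_freeDecaySet_of_rate`). The hypothesis is the natural output of the pointwise Pirogov–Sinai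
analysis (Grimmett 2006, Thm. (7.42): for `q > Q(d)` and every `p` of a window around `p̃(q)`,
`b_w(p) = 0` — whence (7.79), uniform wired percolation with `c = 1 - e^{-aτ(q)}` — or `b_f(p) = 0` —
whence (7.81), the free Peierls bound with rate `e^{-kτ(q) m}` independent of `p`); it is NOT
proved in the tree (it is the proof obligation shared with `RandomClusterFirstOrder`).
[cite: Grimmett2006, Thm. (7.33)(b) and its proof, eqs. (7.78)–(7.83); Thm. (7.42), eqs. (7.46), (7.62)] -/
theorem RandomClusterFirstOrderNarrow_of_dichotomyRate
    (h : ∀ d : ℕ, 2 ≤ d → ∃ Q : ℝ, ∀ q : ℝ, Q < q → 1 ≤ q →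
      ∃ pbot ptop c : ℝ, ∃ δ : ℕ → ℝ, 0 < c ∧ 0 ≤ pbot ∧ pbot ≤ ptop ∧ ptop < 1 ∧
        Tendsto δ atTop (𝓝 0) ∧
        (∀ p ∈ Set.Icc pbot ptop, p ∈ wiredPercolationSet d q c ∨
          ∀ m k : ℕ, boxFreeReal d p q m (originToBoundary d m) k ≤ δ m) ∧
        ptop ∈ wiredPercolationSet d q c ∧
        ∀ m k : ℕ, boxFreeReal d pbot q m (originToBoundary d m) k ≤ δ m) :
    RandomClusterFirstOrderNarrow := by
  intro d hd
  obtain ⟨Q, hQ⟩ := h d hd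
  refine ⟨Q, fun q hQq hq => ?_⟩
  obtain ⟨pbot, ptop, c, δ, hc, hbot, hbt, htop, hδ, hdich, hWP, hFD⟩ := hQ q hQq hq
  have hd0 : 0 < d := lt_of_lt_of_le two_pos hd
  refine ⟨rcCriticalProb_mem_freeDecaySet_of_dichotomyRate hd0 hq hc hbot hbt htop hδ hdich hWP hFD,
    ?_⟩
  have hdich' : ∀ p ∈ Set.Icc pbot ptop, p ∈ wiredPercolationSet d q c ∨ p ∈ freeDecaySet d q :=
    fun p hp => (hdich p hp).imp_right fun hfree => mem_freeDecaySet_of_rate hδ hfree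
  exact hc.trans_le (le_thetaWired_rcCriticalProb_of_dichotomy hd0 hq hc hbot hbt htop hdich' hWP
    (mem_freeDecaySet_of_rate hδ hFD))

/-! ### The assembly: `RandomClusterFirstOrderNarrow_holds`

The window dichotomy of `Literature.Barriers.CriticalPhenomena.RandomClusterFirstOrderPS` kept in the
quantitative form in which the Peierls argument produces the free alternative: the tail bound
`B^{m+1}/(1-B)` (`RCC.sum_K_hull_ge_le`) has a ratio `B = B(q)` independent of `p`, so the hypothesis
of `RandomClusterFirstOrderNarrow_of_dichotomyRate` holds with `δ_m = B^m/(1-B)`. -/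

section Assembly

open scoped Classical

open Finset Literature.Probability.LatticeModels.RCC Literature.Probability.LatticeModels.ContourSetup
  RandomClusterFirstOrderPS

/-- **Stability of `dis` gives the free Peierls bound, rate form** (`p = t²/(1+t²)` in the window,
stable regime, `B ≤ 1/4`): for `m ≥ 1` and every `k`,
`φ⁰_{Λ_{m+k},p,q}(0 ↔ ∂Λ_m in Λ_m) ≤ B^{m+1}/(1-B)`, `B = 2·9^d·4^{3^d}·e^{-τ̂(q)}` — the free box measure
is the `dis`-ensemble probability of the connection event (`real_rcMeasure_free_eq_ensProb`), which
forces an external contour around the origin of size `≥ m + 1` (`exists_big_hull_of_pm`), whose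
probability is summed by `ensProb_exists_le` and `sum_K_hull_ge_le`. This is the body of
`RandomClusterFirstOrderPS.mem_freeDecaySet_of_dis` with the bound kept explicit.
[cite: Grimmett2006, §7.5, proof of Thm. (7.33), eqs. (7.81)–(7.82)] [cite: FriedliVelenik2017, §7.3, Lemma 7.26 and §7.4.3, Prop. 7.34] -/
private theorem boxFreeReal_le_of_dis (hd : 2 ≤ d) {q : ℝ} (hq : 1 ≤ q) {t : ℝ} (ht : 0 < t)
    (hs : |2 * d * Real.log t - Real.log q| ≤ 1) (hreg : StableRegime d q)
    (hσ : (rcModel d ht (q_pos_of_one_le hq)).excess (rcPeierlsRate d q - 4 ^ (d + 2)) Phase.dis = 0)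
    (hB : Bof d q ≤ 1 / 4) {m : ℕ} (hm : 1 ≤ m) (k : ℕ) :
    boxFreeReal d (pOf t) q m (originToBoundary d m) k ≤ Bof d q ^ (m + 1) / (1 - Bof d q) := by
  have hB1 : Bof d q < 1 := by linarith
  have hK : ∀ γ : (rcSetup d).Γ, (rcSetup d).type γ = Phase.dis →
      (rcModel d ht (q_pos_of_one_le hq)).K γ ≤ Real.exp (-tauHat d q * (rcSetup d).size γ) :=
    fun γ hγ => K_le_of_stable hd hq ht hs hreg hσ γ hγ
  -- the free box measure is the ensemble probability of `Pm m`
  have hid : boxFreeReal d (pOf t) q m (originToBoundary d m) k =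
      ensProb t q Phase.dis (box d (m + k + 3)) (Pm m) := by
    have h := real_rcMeasure_free_eq_ensProb (d := d) (m + k) ht (q_pos_of_one_le hq) (Pm m)
      (fun ω => pm_iff_pm_inter (box_mono d (Nat.le_add_right m k)) ω)
      (finsetRestrict (box_mono d (Nat.le_add_right m k)) ⁻¹' originToBoundary d m) fun ωb hωb => by
        rw [Set.mem_preimage]
        exact mem_preimage_origin_iff (box_mono d (Nat.le_add_right m k)) hωb
    rw [boxFreeReal]
    convert h using 2
  have hB1' : (2 : ℝ) * 9 ^ d * 4 ^ 3 ^ d * Real.exp (-tauHat d q) < 1 := hB1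
  have h1 := ensProb_exists_le hd ht (q_pos_of_one_le hq) (starConn_compl_box hd (m + k + 3)) (σ := Phase.dis)
    (fun γ => (0 : Site d) ∈ (rcSetup d).hull γ ∧ m + 1 ≤ (rcSetup d).size γ)
  have h2 := sum_K_hull_ge_le hd ht (q_pos_of_one_le hq) (σ := Phase.dis) (box d (m + k + 3)) hK hB1' m
  rw [hid]
  refine le_trans ?_ (h1.trans (h2.trans_eq rfl))
  refine ensProb_mono ht (q_pos_of_one_le hq) fun ω hω hP => ?_
  obtain ⟨γ, hγ, h0, hsz⟩ := exists_big_hull_of_pm (m + k) hd hm hω hP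
  exact ⟨γ, by rw [xc_eq hω]; exact hγ, h0, hsz⟩

/-- **Grimmett 2006, Thm. (7.33)(b), both halves — PROVED**: for `d ≥ 2` there is `Q = Q(d)` such that
for every real `q > Q` with `q ≥ 1` the free box measures decay at `p_c(q)` (`p_c(q) ∈ freeDecaySet d q`,
i.e. `θ⁰(p_c(q), q) = 0` in the tree's finite-volume language) and the wired phase percolates,
`θ¹(p_c(q), q) > 0`. Proof: for `q > Qof d` (stable regime of the random-cluster contour model and
Peierls ratio `B(q) ≤ 1/4`, `RandomClusterFirstOrderPS.conditions_of_gt`), on the window `t ∈ [t_bot, t_top]`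
(`|2d log t - log q| ≤ 1`, `p = t²/(1+t²)`) some phase has zero excess at every `t`
(`RandomClusterFirstOrderPS.exists_stable`, Grimmett's (7.62)); if `ord`, the wired boxes percolate
uniformly with `c = 1/2` (`RandomClusterFirstOrderPS.half_le_thetaWiredBox`, (7.79)); if `dis`, the free
boxes satisfy `φ⁰_{Λ_{m+k},p,q}(0 ↔ ∂Λ_m in Λ_m) ≤ B^m/(1-B)` with `B = B(q)` independent of `p`
(`boxFreeReal_le_of_dis`, (7.81)); `ord` has zero excess at the top of the window and `dis` at the bottom
(`RandomClusterFirstOrderPS.ord_stable_tTop`, `dis_stable_tBot`). This is the hypothesis of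
`RandomClusterFirstOrderNarrow_of_dichotomyRate`, which gives both halves at `p_c(q)` ((7.80), (7.83),
the right-continuity of `θ¹` and the continuity in `p` of the finite-volume free probabilities).
[cite: Grimmett2006, Thm. (7.33)(b) and its proof, eqs. (7.78)–(7.83), with Thm. (7.42), eq. (7.62)] [cite: LaanaitMessagerMiracleSoleRuizShlosman1991, main theorem (= Grimmett2006 Thm. (7.33))] [cite: FriedliVelenik2017, §7.4.3, Prop. 7.34 with §7.3, Lemma 7.26] -/
theorem RandomClusterFirstOrderNarrow_holds : RandomClusterFirstOrderNarrow := by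
  refine RandomClusterFirstOrderNarrow_of_dichotomyRate fun d hd => ⟨Qof d, fun q hQ hq => ?_⟩
  have hd1 : 1 ≤ d := by omega
  obtain ⟨hreg, hB⟩ := conditions_of_gt hd1 hq hQ
  have hq0 : 0 < q := q_pos_of_one_le hq
  have hd1' : (1 : ℝ) ≤ d := by exact_mod_cast hd1
  have hd0 : (0 : ℝ) < 2 * d := by linarith
  have hB0 : 0 ≤ Bof d q := by rw [Bof]; positivity
  have hB1 : Bof d q < 1 := by linarith
  -- the window in `t` and in `p`
  have htb : 0 < tBot d q := Real.exp_pos _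
  have htt : 0 < tTop d q := Real.exp_pos _
  have hbt : tBot d q ≤ tTop d q := Real.exp_le_exp.2 (div_le_div_of_nonneg_right (by linarith) hd0.le)
  have hwin : ∀ t, tBot d q ≤ t → t ≤ tTop d q → |2 * d * Real.log t - Real.log q| ≤ 1 := by
    intro t h1 h2
    have ht : 0 < t := htb.trans_le h1
    have hl1 := Real.log_le_log htb h1
    have hl2 := Real.log_le_log ht h2
    rw [tBot, Real.log_exp] at hl1
    rw [tTop, Real.log_exp] at hl2
    rw [abs_le]
    constructor
    · have := mul_le_mul_of_nonneg_left hl1 hd0.le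
      rw [mul_div_cancel₀ _ hd0.ne'] at this; linarith
    · have := mul_le_mul_of_nonneg_left hl2 hd0.le
      rw [mul_div_cancel₀ _ hd0.ne'] at this; linarith
  -- the free rate `δ_m = B^m/(1-B)`, independent of `p`, vanishes
  have hδ : Tendsto (fun m : ℕ => Bof d q ^ m / (1 - Bof d q)) atTop (𝓝 0) := by
    simpa using (tendsto_pow_atTop_nhds_zero_of_lt_one hB0 hB1).div_const (1 - Bof d q)
  -- the free bound for every `m` from the stability of `dis` at `t`
  have hfree : ∀ {t : ℝ} (ht : 0 < t), |2 * d * Real.log t - Real.log q| ≤ 1 →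
      (rcModel d ht hq0).excess (rcPeierlsRate d q - 4 ^ (d + 2)) Phase.dis = 0 →
        ∀ m k : ℕ, boxFreeReal d (pOf t) q m (originToBoundary d m) k ≤ Bof d q ^ m / (1 - Bof d q) := by
    intro t ht hs hσ m k
    rcases Nat.eq_zero_or_pos m with rfl | hm
    · -- a probability is at most `1 ≤ 1/(1-B) = δ_0`
      rw [pow_zero]
      have hp : pOf t ∈ Set.Icc (0 : ℝ) 1 := ⟨(pOf_mem t ht).1.le, (pOf_mem t ht).2.le⟩
      exact (boxFreeReal_le_one d hp hq0 0 _ k).trans ((one_le_div (by linarith)).2 (by linarith))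
    · exact (boxFreeReal_le_of_dis hd hq ht hs hreg hσ hB hm k).trans
        (div_le_div_of_nonneg_right (pow_le_pow_of_le_one hB0 hB1.le m.le_succ) (by linarith))
  refine ⟨pOf (tBot d q), pOf (tTop d q), 1 / 2, fun m => Bof d q ^ m / (1 - Bof d q), by norm_num,
    (pOf_mem _ htb).1.le, pOf_le_pOf htb.le hbt, (pOf_mem _ htt).2, hδ, fun p hp => ?_, ?_, ?_⟩
  · -- interior points: `p = pOf (tOf p)` with `tOf p` in the window; some phase is stable there
    obtain ⟨hp1, hp2⟩ := hp
    have hp0 : 0 ≤ p := (pOf_mem _ htb).1.le.trans hp1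
    have hp1' : p < 1 := hp2.trans_lt (pOf_mem _ htt).2
    have hrep : pOf (tOf p) = p := pOf_tOf hp0 hp1'
    have ht1 : tBot d q ≤ tOf p := by rw [← tOf_pOf htb]; exact tOf_le_tOf (pOf_mem _ htb).1.le hp1 hp1'
    have ht2 : tOf p ≤ tTop d q := by rw [← tOf_pOf htt]; exact tOf_le_tOf hp0 hp2 (pOf_mem _ htt).2
    have htp : 0 < tOf p := htb.trans_le ht1
    rw [← hrep]
    obtain ⟨σ, hσ⟩ := exists_stable hq htp
    cases σ with
    | ord => exact Or.inl fun n => half_le_thetaWiredBox hd hq htp (hwin _ ht1 ht2) hreg hσ hB n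
    | dis => exact Or.inr (hfree htp (hwin _ ht1 ht2) hσ)
  · -- top: `ord` is stable
    exact fun n => half_le_thetaWiredBox hd hq htt (hwin _ hbt le_rfl) hreg (ord_stable_tTop hd hq hreg) hB n
  · -- bottom: `dis` is stable
    exact hfree htb (hwin _ le_rfl hbt) (dis_stable_tBot hd hq hreg)

end Assembly

end Literature.Barriers.CriticalPhenomena

end
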